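import Literature.Computability.Learning.NaturalLearningPredictor
import Literature.Computability.Complexity.DirectProductDecoder
import Literature.Computability.MetaComplexity.TruthTables
import HarnessLib

/-!
# Steps towards `cikk_natural_implies_learning`: one run of the CIKK pipeline succeeds

Seventh instalment of the decomposition of the named fact
`Literature.Computability.Learning.cikk_natural_implies_learning` (CIKK 2016, Thm. 5.1): the
composition of the three reconstruction stages in exact counting form. For a Boolean function
`f : {0,1}ⁿ → {0,1}`, a design `e` with `L` blocks on the `kn + k` input positions of
`AMP(f) = (f^k)^{GL}` (`ampFnFin`), and a test `D` with advantage `≥ 1/5` against the NW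
generator of `AMP(f)` (the natural property, `advantage_not_propertyTest_ge`), ONE RUN of the
learner draws uniform coins

  `ω = (i, z, w ; sd, σ ; Pb, a, steps)`

(block and advice of the NW predictor; Goldreich–Levin seed tuple and guess; trusted position
bits, trusted tuple and sampling steps of the direct-product decoder) and outputs the hypothesis
`runHyp e D f ω : {0,1}ⁿ → {0,1}` = IJKW decoder ∘ Rackoff candidate ∘ NW predictor
(CIKK §5, "the complete algorithm", steps 1–5). **`card_goodRun_ge`**: under explicit
conditions on the parameters `(L, k, kk, t)` the hypothesis errs on at most `δ₁ 2ⁿ` inputs for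
at least a `p₀ = η ε' (3ε'/16)(1 - 2e^{-k/8})` fraction of the coins, `η = 1/(10L)`,
`ε' = η/(4·2^kk)` (`card_goodAdvice_ge`, `card_goodSeedGuess_ge`, `directProduct_decoding_bits`
chained by `card_filter_prod_ge_mul`).

## References

* M. Carmosino, R. Impagliazzo, V. Kabanets, A. Kolokolova, *Learning algorithms from natural
  proofs*, CCC 2016, Thm. 5.1 and §5 ("the complete algorithm", steps 1–5), Thms. 2.11, 4.1,
  4.2, Claim 4.4 [CarmosinoImpagliazzoKabanetsKolokolova2016].
* R. Impagliazzo, R. Jaiswal, V. Kabanets, A. Wigderson, *Uniform direct product theorems*,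
  SIAM J. Comput. 39 (2010), Thm. 1.2 [ImpagliazzoEtAl2010].
-/

open Finset Matrix

namespace Literature.Computability.Learning

open Literature.Computability.MetaComplexity Literature.Computability.Cryptography
  Literature.Computability.Complexity Literature.Computability.Complexity.DirectProduct

variable {n k : ℕ}

/-! ### The hypothesis produced by one run -/

section Run

variable {L m kk t : ℕ}

/-- The coins of the NW stage: block `i`, seed part `z`, hybrid bits `w`. [folklore] -/
abbrev AdvCoins (L m : ℕ) : Type := Fin L × (Fin m → Bool) × (Fin L → Bool)

/-- The coins of the GL stage: seed tuple `sd` and guess `σ`. [folklore] -/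
abbrev SGCoins (k kk : ℕ) : Type := (Fin kk → BVec k) × (Fin kk → ZMod 2)

/-- The coins of the DP stage: trusted-position bits `Pb`, trusted tuple `a`, sampling steps.
[folklore] -/
abbrev DCCoins (n k t : ℕ) : Type :=
  (Fin k → Bool) × (Fin k → (Fin n → Bool)) × (Fin t → Fin k × (Fin k → (Fin n → Bool)))

/-- The coins of one run: NW stage, GL stage, DP stage. [folklore] -/
abbrev RunCoins (n k L m kk t : ℕ) : Type := AdvCoins L m × SGCoins k kk × DCCoins n k t

variable (e : Fin L → (Fin (k * n + k) ↪ Fin m)) (D : (Fin L → Bool) → Bool)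
  (f : (Fin n → Bool) → Bool)

/-- Stage 1 output: the NW predictor for `AMP(f)` with advice `(i, z, w)`.
[cite: CarmosinoImpagliazzoKabanetsKolokolova2016, §5 (complete algorithm, step 3)] -/
noncomputable def nwStage (adv : AdvCoins L m) :
    (Fin (k * n + k) → Bool) → Bool :=
  nwPredictor e (ampFnFin f k) D adv.1 adv.2.1 adv.2.2

/-- The predictor of the GL bit `⟨f^k(x⃗), r⟩` read off a predictor `h₁` for `AMP(f)`.
[cite: CarmosinoImpagliazzoKabanetsKolokolova2016, Claim 4.4 (proof: "`B_x(r) := C'(x, r)`")] -/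
def glOracle (h₁ : (Fin (k * n + k) → Bool) → Bool) (p : (Fin k → (Fin n → Bool)) × BVec k) :
    ZMod 2 :=
  boolToZMod (h₁ (((ampEquiv n k).symm p) ∘ (ampIdxEquiv n k).symm))

/-- Stage 2 output: Rackoff's candidate for `f^k(x⃗)` with seed tuple and guess `(sd, σ)`, as a
`Bool`-valued direct-product oracle.
[cite: CarmosinoImpagliazzoKabanetsKolokolova2016, §5 (complete algorithm, step 4)] -/
noncomputable def glStage (h₁ : (Fin (k * n + k) → Bool) → Bool)
    (sg : SGCoins k kk) : (Fin k → (Fin n → Bool)) → Fin k → Bool :=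
  fun xs c => zmodToBool (glCandidate (fun r => glOracle h₁ (xs, r)) kk sg.1 sg.2 c)

/-- **The hypothesis of one run**: the IJKW decoder (trusted positions `posSet Pb`, trusted tuple
`a` with its TRUE values `f ∘ a` obtained by membership queries, fixed sampling steps) on top of
the GL stage on top of the NW stage.
[cite: CarmosinoImpagliazzoKabanetsKolokolova2016, §5 (complete algorithm, steps 1–5)] -/
noncomputable def runHyp (ω : RunCoins n k L m kk t) : (Fin n → Bool) → Bool :=
  decode (glStage (nwStage e D f ω.1) ω.2.1) (posSet ω.2.2.1) ω.2.2.2.1 (f ∘ ω.2.2.2.1) false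
    ω.2.2.2.2

/-! ### Bridges between the stages -/

/-- The agreement of a predictor with `AMP(f)` on enumerated bits is its success in predicting
the GL bit of `f^k` (Stage 1 → Stage 2). [cite: CarmosinoImpagliazzoKabanetsKolokolova2016, Claim 4.4] -/
theorem card_glOracle_eq (h₁ : (Fin (k * n + k) → Bool) → Bool) :
    ((univ.filter fun p : (Fin k → (Fin n → Bool)) × BVec k =>
        glOracle h₁ p = dpGL f p).card : ℝ) =
      agreement h₁ (ampFnFin f k) * Fintype.card (Fin (k * n + k) → Bool) := by
  have hN : (0 : ℝ) < Fintype.card (Fin (k * n + k) → Bool) := Nat.cast_pos.2 Fintype.card_pos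
  rw [agreement, div_mul_cancel₀ _ hN.ne']
  -- reindex `Fin (kn+k) → Bool` by `AmpIdx n k → Bool`
  set ρ : (Fin (k * n + k) → Bool) ≃ (AmpIdx n k → Bool) :=
    Equiv.arrowCongr (ampIdxEquiv n k).symm (Equiv.refl Bool) with hρ
  have h1 : (univ.filter fun v : Fin (k * n + k) → Bool => h₁ v = ampFnFin f k v).card =
      (univ.filter fun u : AmpIdx n k → Bool =>
        h₁ (u ∘ (ampIdxEquiv n k).symm) = ampFn f k (u ∘ (ampIdxEquiv n k).symm ∘ ampIdxEquiv n k)).card := by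
    rw [← card_filter_univ_equiv ρ.symm]
    rfl
  have h2 : ∀ u : AmpIdx n k → Bool, u ∘ (ampIdxEquiv n k).symm ∘ ampIdxEquiv n k = u := by
    intro u; funext c; simp
  simp only [h2] at h1
  rw [h1, card_agree_ampFn_eq]
  rfl

/-- The GL stage computes `f^k(x⃗)` exactly iff Rackoff's candidate is the vector `f^k(x⃗)`
(Stage 2 → Stage 3). [folklore] -/
theorem errSet_glStage_eq_empty_iff (h₁ : (Fin (k * n + k) → Bool) → Bool)
    (sg : SGCoins k kk) (xs : Fin k → (Fin n → Bool)) :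
    errSet (glStage h₁ sg) f xs = ∅ ↔
      glCandidate (fun r => glOracle h₁ (xs, r)) kk sg.1 sg.2 = dpVec f xs := by
  rw [errSet_eq_empty_iff, funext_iff]
  refine forall_congr' fun c => ?_
  simp only [glStage, dpVec]
  generalize glCandidate (fun r => glOracle h₁ (xs, r)) kk sg.1 sg.2 c = u
  generalize f (xs c) = b
  revert u b
  decide

/-! ### One run succeeds with noticeable probability -/

/-- **One run of the CIKK learner succeeds with probability `≥ p₀`** (exact counting form of
the composition Thm. 2.11 ∘ Claim 4.4 ∘ Thm. 4.1 inside the proof of Thm. 5.1). Let `D` have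
advantage `≥ 1/5` against the NW generator of `AMP(f)` on the design `e` (`L ≥ 1` blocks), put
`η = 1/(10L)`, `ε' = η/(4·2^kk)`, and assume the Goldreich–Levin condition
`k ≤ (η²/8)(2^kk - 1)` and the direct-product conditions (`H1u`–`H3u` of
`directProduct_decoding_bits` with `ε := ε'`, `δ := δ₁`). Then for at least a
`η · ε' · (3ε'/16)(1 - 2e^{-k/8})` fraction of the coins `ω`, the hypothesis `runHyp e D f ω`
disagrees with `f` on at most `δ₁ · 2ⁿ` inputs.
[cite: CarmosinoImpagliazzoKabanetsKolokolova2016, Thm. 5.1 (proof) with §5 (complete algorithm)] -/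
theorem card_goodRun_ge (hL : 0 < L) (hk : 0 < k) (hkk : 0 < kk)
    (hadv : (1 / 5 : ℝ) ≤ advantage D (nwGenerator e (ampFnFin f k))) {δ₁ : ℝ} (hδ₁ : 0 < δ₁)
    (hGL : (k : ℝ) ≤ 2 * (1 / (10 * L) / 2) ^ 2 * (2 ^ kk - 1 : ℕ))
    (H1u : Real.exp (-(3 * δ₁ * k / 2048)) ≤ (1 / (10 * L) / (4 * 2 ^ kk)) ^ 2 * δ₁ / 4096)
    (H2u : Real.exp (-(k * δ₁ ^ 2 / 2048)) ≤ 1 / (10 * L) / (4 * 2 ^ kk) / 4)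
    (H3u : Real.exp (-(t * (1 / (10 * L) / (4 * 2 ^ kk)) / 32)) ≤ δ₁ / 16) :
    1 / (10 * L) * (1 / (10 * L) / (4 * 2 ^ kk)) *
        (3 * (1 / (10 * L) / (4 * 2 ^ kk)) / 16 * (1 - 2 * Real.exp (-(k / 8 : ℝ)))) *
        Fintype.card (RunCoins n k L m kk t) ≤
      ((univ.filter fun ω : RunCoins n k L m kk t =>
        ((univ.filter fun x => runHyp e D f ω x ≠ f x).card : ℝ) ≤
          δ₁ * Fintype.card (Fin n → Bool)).card : ℝ) := by
  classical
  set η : ℝ := 1 / (10 * L) with hη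
  set ε' : ℝ := η / (4 * 2 ^ kk) with hε'
  have hL' : (0 : ℝ) < L := Nat.cast_pos.2 hL
  have hη0 : 0 < η := by positivity
  have hε'0 : 0 < ε' := by positivity
  -- Stage 1: good NW advice
  have h1 : η * Fintype.card (AdvCoins L m) ≤ ((univ.filter fun adv : AdvCoins L m =>
      1 / 2 + η ≤ agreement (nwStage e D f adv) (ampFnFin f k)).card : ℝ) := by
    have h := card_goodAdvice_ge e (ampFnFin f k) D hL (adv := 1 / 5) (by norm_num) hadv
    have hηeq : (1 / 5 : ℝ) / (2 * L) = η := by rw [hη]; field_simp; ring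
    rw [hηeq] at h
    exact h
  -- Stage 2: for good advice, good (seed, guess) pairs
  have h2 : ∀ adv ∈ (univ.filter fun adv : AdvCoins L m =>
      1 / 2 + η ≤ agreement (nwStage e D f adv) (ampFnFin f k)),
      ε' * Fintype.card (SGCoins k kk) ≤ ((univ.filter fun sg : SGCoins k kk =>
        ε' * Fintype.card (Fin k → (Fin n → Bool)) ≤
          ((univ.filter fun xs : Fin k → (Fin n → Bool) =>
            glCandidate (fun r => glOracle (nwStage e D f adv) (xs, r)) kk sg.1 sg.2 =
              dpVec f xs).card : ℝ)).card : ℝ) := by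
    intro adv hadv1
    have hagree := (mem_filter.1 hadv1).2
    have hcount : (1 / 2 + η) * (Fintype.card (Fin k → (Fin n → Bool)) * Fintype.card (BVec k)) ≤
        ((univ.filter fun p : (Fin k → (Fin n → Bool)) × BVec k =>
          glOracle (nwStage e D f adv) p = dpGL f p).card : ℝ) := by
      rw [card_glOracle_eq, ← Nat.cast_mul, ← card_ampIdx_fun,
        Fintype.card_congr (Equiv.arrowCongr (ampIdxEquiv n k) (Equiv.refl Bool))]
      exact mul_le_mul_of_nonneg_right hagree (Nat.cast_nonneg _)
    exact card_goodSeedGuess_ge f hkk (fun p => glOracle (nwStage e D f adv) p) hη0 hGL hcount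
  have h12 := card_filter_prod_ge_mul _ _ hε'0.le h1 h2
  -- Stage 3: for good (advice, seed, guess), good decoder coins
  set GA₁₂ := (univ : Finset (AdvCoins L m × SGCoins k kk)).filter fun as =>
    as.1 ∈ (univ.filter fun adv : AdvCoins L m =>
      1 / 2 + η ≤ agreement (nwStage e D f adv) (ampFnFin f k)) ∧
    ε' * Fintype.card (Fin k → (Fin n → Bool)) ≤
      ((univ.filter fun xs : Fin k → (Fin n → Bool) =>
        glCandidate (fun r => glOracle (nwStage e D f as.1) (xs, r)) kk as.2.1 as.2.2 =
          dpVec f xs).card : ℝ) with hGA₁₂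
  have h3 : ∀ as ∈ GA₁₂,
      3 * ε' / 16 * (1 - 2 * Real.exp (-(k / 8 : ℝ))) * Fintype.card (DCCoins n k t) ≤
        ((univ.filter fun dc : DCCoins n k t =>
          ((univ.filter fun x => decode (glStage (nwStage e D f as.1) as.2) (posSet dc.1) dc.2.1
            (f ∘ dc.2.1) false dc.2.2 x ≠ f x).card : ℝ) ≤
              δ₁ * Fintype.card (Fin n → Bool)).card : ℝ) := by
    intro as has
    obtain ⟨-, hg2⟩ := (mem_filter.1 has).2
    have hC : ε' * Fintype.card (Fin k → (Fin n → Bool)) ≤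
        ((univ.filter fun xs : Fin k → (Fin n → Bool) =>
          errSet (glStage (nwStage e D f as.1) as.2) f xs = ∅).card : ℝ) := by
      refine hg2.trans (le_of_eq ?_)
      congr 2
      exact Finset.filter_congr fun xs _ => (errSet_glStage_eq_empty_iff f _ _ xs).symm
    exact directProduct_decoding_bits (glStage (nwStage e D f as.1) as.2) f hk hε'0 hδ₁ hC
      H1u H2u H3u false
  -- the target event, transported to `(AdvCoins × SGCoins) × DCCoins`
  have htarget : ((univ.filter fun ω : RunCoins n k L m kk t =>
      ((univ.filter fun x => runHyp e D f ω x ≠ f x).card : ℝ) ≤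
        δ₁ * Fintype.card (Fin n → Bool)).card : ℝ) =
      ((univ.filter fun ω' : (AdvCoins L m × SGCoins k kk) × DCCoins n k t =>
        ((univ.filter fun x => decode (glStage (nwStage e D f ω'.1.1) ω'.1.2) (posSet ω'.2.1)
          ω'.2.2.1 (f ∘ ω'.2.2.1) false ω'.2.2.2 x ≠ f x).card : ℝ) ≤
            δ₁ * Fintype.card (Fin n → Bool)).card : ℝ) := by
    rw [← card_filter_univ_equiv (Equiv.prodAssoc (AdvCoins L m) (SGCoins k kk) (DCCoins n k t))]
    rfl
  have hcardΩ : (Fintype.card (RunCoins n k L m kk t) : ℝ) =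
      Fintype.card (AdvCoins L m × SGCoins k kk) * Fintype.card (DCCoins n k t) := by
    rw [← Nat.cast_mul, ← Fintype.card_prod]
    exact_mod_cast (Fintype.card_congr
      (Equiv.prodAssoc (AdvCoins L m) (SGCoins k kk) (DCCoins n k t))).symm
  rw [htarget, hcardΩ]
  by_cases hq : 0 ≤ 1 - 2 * Real.exp (-(k / 8 : ℝ))
  · have h123 := card_filter_prod_ge_mul GA₁₂ _ (p := η * ε')
      (q := 3 * ε' / 16 * (1 - 2 * Real.exp (-(k / 8 : ℝ)))) (mul_nonneg (by positivity) hq)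
      (by rw [Fintype.card_prod]; push_cast; exact h12) h3
    refine le_trans (le_of_eq (by ring)) (h123.trans ?_)
    exact_mod_cast card_le_card (monotone_filter_right _
      fun (ω' : (AdvCoins L m × SGCoins k kk) × DCCoins n k t) _ h => And.right h)
  · rw [not_le] at hq
    refine le_trans ?_ (Nat.cast_nonneg _)
    have hpos : (0 : ℝ) ≤ η * ε' * (3 * ε' / 16) *
        (Fintype.card (AdvCoins L m × SGCoins k kk) * Fintype.card (DCCoins n k t)) := by
      positivity
    nlinarith

end Run

/-! ### The learner's test: the complement of the natural property -/

section Test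

variable {σ : Type*} [Fintype σ] [DecidableEq σ]

/-- **The test used by the learner**: an `L = 2^ℓ`-bit string, read as the truth table (in the
order `boolFunEquivFin`) of an `ℓ`-variate function, is accepted iff that function does NOT have
the property `R_ℓ` (CIKK proof of Thm. 5.1: "`¬D` is a `1/5`-distinguisher").
[cite: CarmosinoImpagliazzoKabanetsKolokolova2016, Thm. 5.1 (proof)] -/
noncomputable def natTest (R : CombinatorialProperty) (ℓ : ℕ) : (Fin (2 ^ ℓ) → Bool) → Bool :=
  fun y => ! propertyTest R ℓ (y ∘ boolFunEquivFin ℓ)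

/-- The truth table of the function read off an `L`-bit string is the string itself. [folklore] -/
theorem truthTable_comp_boolFunEquivFin {ℓ : ℕ} (y : Fin (2 ^ ℓ) → Bool) :
    truthTable (y ∘ boolFunEquivFin ℓ) = List.ofFn y := by
  unfold truthTable
  congr 1
  funext i
  simp

/-- **The complement of a dense, useful property distinguishes with advantage `≥ 1/5`**
(Fin-indexed form of `advantage_not_propertyTest_ge`): if `R_ℓ` has density `≥ 1/5` and no
output string of the generator `G'`, read as an `ℓ`-variate function, has the property, then
`natTest R ℓ` has advantage `≥ 1/5` against `G'`.
[cite: CarmosinoImpagliazzoKabanetsKolokolova2016, Thm. 5.1 (proof)] -/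
theorem natTest_advantage_ge (R : CombinatorialProperty) (ℓ : ℕ)
    (hR : 2 ^ (2 ^ ℓ) ≤ 5 * Nat.card (R ℓ)) (G' : (σ → Bool) → (Fin (2 ^ ℓ) → Bool))
    (hG : ∀ z, (G' z ∘ boolFunEquivFin ℓ) ∉ R ℓ) :
    (1 / 5 : ℝ) ≤ advantage (natTest R ℓ) G' := by
  have h := advantage_not_propertyTest_ge R ℓ (q := 5) (by norm_num) hR
    (fun z => G' z ∘ boolFunEquivFin ℓ) hG
  rw [← advantage_reindex (boolFunEquivFin ℓ)] at h
  refine h.trans (le_of_eq ?_)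
  simp only [Function.comp_assoc, Equiv.self_comp_symm, Function.comp_id]
  rfl

/-- **The learner's NW design**: the explicit design of CIKK §3.1 over `𝔽_q`, `q ≥ kn + k` prime,
with blocks of size `kn + k` (the inputs of `AMP(f)`) indexed by `Fin (2^ℓ)` through the
standard enumeration of `{0,1}^ℓ`. [cite: CarmosinoImpagliazzoKabanetsKolokolova2016, §3.1] -/
noncomputable def learnerDesign (q n k ℓ : ℕ) [Fact q.Prime] (hn : k * n + k ≤ q) :
    Fin (2 ^ ℓ) → (Fin (k * n + k) ↪ Fin (q * q)) :=
  fun i => cikkDesign q (k * n + k) ℓ hn ((boolFunEquivFin ℓ).symm i)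

/-- The learner's design is an NW design with intersections `≤ ℓ`.
[cite: CarmosinoImpagliazzoKabanetsKolokolova2016, §3.1] -/
theorem isNWDesign_learnerDesign (q n k ℓ : ℕ) [Fact q.Prime] (hn : k * n + k ≤ q) :
    IsNWDesign ℓ (learnerDesign q n k ℓ hn) :=
  (isNWDesign_cikkDesign q (k * n + k) ℓ hn).comp_injective (boolFunEquivFin ℓ).symm.injective

/-- The NW output `g_z` of the learner's generator, read as an `ℓ`-variate function, is
`v ↦ AMP(f)(z|_{S_v})`. [folklore] -/
theorem nwGenerator_learnerDesign_comp (q n k ℓ : ℕ) [Fact q.Prime] (hn : k * n + k ≤ q)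
    (f : (Fin n → Bool) → Bool) (z : Fin (q * q) → Bool) :
    (nwGenerator (learnerDesign q n k ℓ hn) (ampFnFin f k) z) ∘ boolFunEquivFin ℓ =
      fun v => ampFnFin f k (z ∘ cikkDesign q (k * n + k) ℓ hn v) := by
  funext v
  simp [learnerDesign, nwGenerator]

end Test

end Literature.Computability.Learning
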